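import Summits.CriticalPhenomena.CardyFormulaZ2.Theorems.CardyBoundaryCoulombGasBoundaryDefectGaussianRS18Rainbow22Part2
import Summits.CriticalPhenomena.CardyFormulaZ2.Theorems.CardyBoundaryCoulombGasBoundaryDefectGaussianRS18Rainbow22Part3
import Summits.CriticalPhenomena.CardyFormulaZ2.Theorems.CardyBoundaryCoulombGasBoundaryDefectGaussianRStubDictionaryPositivity
import Summits.CriticalPhenomena.CardyFormulaZ2.Theorems.CardyBoundaryCoulombGasBoundaryDefectGaussianRStubClusterLocalityV2Part11
import Literature.Probability.LatticeModels.CollarLegModelCharts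

/-!
# The `(2;2)` member of rainbow locality — Part 4: RAINBOW LOCALITY for `k = 2`, `L = ![2, 2]`
# (crux `BoundaryDefectGaussianR`, stmt-CriticalPhenomena-14132; line `rainbow-monomials-in-excursion-kernels`)

The open stub `stub_rainbowLocality` of the line asks, for every leg family, for the locality of
`log (‖Zins_V(p)‖ / ‖Z_V‖)` in the domain: chart-regular `V, V'` with king-connected complements agreeing
with half-planes on the balls of radius `M·m` about `a, a'`, insertion points `p` within `m` of `a`
(translated by `a' - a` for `V'`). This file proves its `(2;2)` MEMBER — `k = 2`, `L = ![2, 2]`, `j = 1`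
substituted in the registered text (`s18_rainbowLocality_22`, registered):

* `r22_datum` — the datum `ι(p)` of the stubs for `k = 2`, `L = ![2, 2]`, `j = 1` is the `(2;2)` datum with
  source `p 0` (`2` legs) and sink `p 1`;
* `r22_ball` — the half-plane chart of radius `M·m ≥ 9m` about `a` restricts to the Euclidean ball of
  radius `6` about any point within `m` of `a`; `r22_row` — hence an admissible insertion point (a
  boundary vertex with ONE neighbour outside `V`) within `m` of `a` lies on the row `v.2 = a.2`, and the
  insertion points are FLAT at every radius `r`, `r² ≤ 36`, with inward normal `(0, 1)` (`r22_flat`);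
* `r22_ratio_eq` — **the rainbow ratio is a connection probability**:
  `‖Zins V ι(p)‖ / ‖Z(ofDomain V)‖ = P_{1/2}[p 0 ↔ p 1 in V]` — the insertion dictionary `s17_dictionary`
  (`‖Zins‖ = #{ω ⊆ E : Rainbow}`; configurations exist since the ratio is positive), the closed-collar
  dictionary `norm_Z_ofDomain` (`‖Z‖ = 2^{|E|}`), the identification `s18_rainbow22_iff_conn` (Part 2:
  `Rainbow ↔ {p 0 ↔ p 1 by ω inside V}`) and the count `r22_prob_eq_card` (Part 3);
* `s18_rainbowLocality_22` — with the two-point locality `s12_twoPointLocality`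
  (…StubClusterLocalityV2Part11: `|log P_{1/2}[u ↔ w in V] - log P_{1/2}[u' ↔ w' in V']| ≤ ε` for
  `M ≥ M₀(ε)`), taking `M = max M₀ 9`.

All [folklore] glue over landed theorems; no new objects.
-/

noncomputable section

namespace Summit.CriticalPhenomena.CardyFormulaZ2.Cruxes.BoundaryDefectGaussianR.RainbowMonomialsInExcursionKernels

open MeasureTheory Finset Literature.Probability.LatticeModels Literature.Probability.LatticeModels.CollarLegModel
open Literature.Probability.Percolation

/-! ### The `(2;2)` datum of the stubs -/

/-- `Finset.univ.erase 1 = {0}` in `Fin 2`. [folklore] -/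
theorem r22_univ_erase_one : (Finset.univ.erase (1 : Fin 2)) = {0} := by decide

/-- **The datum `ι(p)` of the stubs for `k = 2`, `L = ![2, 2]`, `j = 1`**: source `{p 0}` with `2` legs,
sink `p 1`. [folklore] -/
theorem r22_datum (p : Fin 2 → ℤ × ℤ) :
    (⟨(Finset.univ.erase 1).image p, fun v ↦ ∑ b ∈ (Finset.univ.erase 1).filter (fun b ↦ p b = v),
        (![2, 2] : Fin 2 → ℕ) b, p 1⟩ : LegInsertionData).source = {p 0} ∧
    (⟨(Finset.univ.erase 1).image p, fun v ↦ ∑ b ∈ (Finset.univ.erase 1).filter (fun b ↦ p b = v),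
        (![2, 2] : Fin 2 → ℕ) b, p 1⟩ : LegInsertionData).legs (p 0) = 2 ∧
    (⟨(Finset.univ.erase 1).image p, fun v ↦ ∑ b ∈ (Finset.univ.erase 1).filter (fun b ↦ p b = v),
        (![2, 2] : Fin 2 → ℕ) b, p 1⟩ : LegInsertionData).sink = p 1 := by
  refine ⟨?_, ?_, rfl⟩
  · show (Finset.univ.erase (1 : Fin 2)).image p = {p 0}
    rw [r22_univ_erase_one, image_singleton]
  · show ∑ b ∈ (Finset.univ.erase (1 : Fin 2)).filter (fun b ↦ p b = p 0), (![2, 2] : Fin 2 → ℕ) b = 2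
    rw [r22_univ_erase_one, Finset.filter_singleton, if_pos rfl, sum_singleton]
    rfl

/-! ### Geometry: the big half-plane chart near the insertion points -/

section Geometry

variable {V : Finset (ℤ × ℤ)} {a : ℤ × ℤ} {m M : ℝ} (hm : 1 ≤ m) (hM : 9 ≤ M)
  (hV : ∀ v : ℤ × ℤ, ((((v.1 - a.1) ^ 2 + (v.2 - a.2) ^ 2 : ℤ) : ℝ)) ≤ (M * m) ^ 2 → (v ∈ V ↔ 0 ≤ v.2 - a.2))
include hm hM hV

/-- **The chart restricts to small balls about points near `a`**: if `z` is within `m` of `a`, every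
lattice point within Euclidean distance `6` of `z` is in `V` iff it lies in the upper half-plane of `a`
(`(v - a)² ≤ 2 (z - a)² + 2 (v - z)² ≤ 2m² + 72 ≤ (9m)²`). [folklore] -/
theorem r22_ball {z : ℤ × ℤ} (hz : ((((z.1 - a.1) ^ 2 + (z.2 - a.2) ^ 2 : ℤ) : ℝ)) ≤ m ^ 2)
    {v : ℤ × ℤ} (hv : (v.1 - z.1) ^ 2 + (v.2 - z.2) ^ 2 ≤ 36) : v ∈ V ↔ 0 ≤ v.2 - a.2 := by
  refine hV v ?_
  have h1 : (v.1 - a.1) ^ 2 + (v.2 - a.2) ^ 2 ≤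
      2 * ((z.1 - a.1) ^ 2 + (z.2 - a.2) ^ 2) + 2 * ((v.1 - z.1) ^ 2 + (v.2 - z.2) ^ 2) := by
    nlinarith [sq_nonneg (v.1 - z.1 - (z.1 - a.1)), sq_nonneg (v.2 - z.2 - (z.2 - a.2))]
  have h2 : (v.1 - a.1) ^ 2 + (v.2 - a.2) ^ 2 ≤ 2 * ((z.1 - a.1) ^ 2 + (z.2 - a.2) ^ 2) + 72 := by omega
  have h3 : ((((v.1 - a.1) ^ 2 + (v.2 - a.2) ^ 2 : ℤ) : ℝ)) ≤
      2 * ((((z.1 - a.1) ^ 2 + (z.2 - a.2) ^ 2 : ℤ) : ℝ)) + 72 := by exact_mod_cast h2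
  have hm2 : (1 : ℝ) ≤ m ^ 2 := by nlinarith
  have hM2 : (81 : ℝ) ≤ M ^ 2 := by nlinarith
  calc ((((v.1 - a.1) ^ 2 + (v.2 - a.2) ^ 2 : ℤ) : ℝ)) ≤ 2 * m ^ 2 + 72 := by linarith
    _ ≤ 81 * m ^ 2 := by linarith
    _ ≤ M ^ 2 * m ^ 2 := by gcongr
    _ = (M * m) ^ 2 := by ring

/-- **An admissible insertion point near `a` lies on the row `v.2 = a.2`**: it is in `V` (so not below
the row) and has a neighbour outside `V` (so not above it). [folklore] -/
theorem r22_row {z : ℤ × ℤ} (hz : ((((z.1 - a.1) ^ 2 + (z.2 - a.2) ^ 2 : ℤ) : ℝ)) ≤ m ^ 2) (hzV : z ∈ V)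
    (hcard : ((neighbours z).filter (fun y ↦ y ∉ V)).card = 1) : z.2 = a.2 := by
  have hz0 : 0 ≤ z.2 - a.2 := (r22_ball hm hM hV hz (v := z) (by simp)).1 hzV
  by_contra hne
  have hpos : 0 < z.2 - a.2 := lt_of_le_of_ne hz0 (fun h => hne (by omega))
  have hall : (neighbours z).filter (fun y ↦ y ∉ V) = ∅ := by
    refine filter_eq_empty_iff.2 fun n hn hnV => hnV ?_
    simp only [neighbours, mem_insert, mem_singleton] at hn
    rcases hn with rfl | rfl | rfl | rfl <;>
      exact (r22_ball hm hM hV hz (by simp)).2 (by simp only; omega)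
  rw [hall, card_empty] at hcard
  exact zero_ne_one hcard

/-- **Flatness at a row point near `a`**, in the form of the dictionary theorems (any radius `r` with
`r² ≤ 36`, inward normal `(0, 1)`). [folklore] -/
theorem r22_flat {z : ℤ × ℤ} (hz : ((((z.1 - a.1) ^ 2 + (z.2 - a.2) ^ 2 : ℤ) : ℝ)) ≤ m ^ 2) (hrow : z.2 = a.2)
    {r : ℤ} (hr : r ^ 2 ≤ 36) :
    ∃ dvec : ℤ × ℤ, (dvec = (1, 0) ∨ dvec = (-1, 0) ∨ dvec = (0, 1) ∨ dvec = (0, -1)) ∧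
      ∀ v : ℤ × ℤ, (v.1 - z.1) ^ 2 + (v.2 - z.2) ^ 2 ≤ r ^ 2 →
        (v ∈ V ↔ 0 ≤ (v.1 - z.1) * dvec.1 + (v.2 - z.2) * dvec.2) := by
  refine ⟨(0, 1), Or.inr (Or.inr (Or.inl rfl)), fun v hv => ?_⟩
  rw [r22_ball hm hM hV hz (hv.trans hr), hrow]
  simp

end Geometry

/-! ### The rainbow ratio of the `(2;2)` datum is a connection probability -/

/-- **`‖Zins V ι(p)‖ / ‖Z(ofDomain V)‖ = P_{1/2}[p 0 ↔ p 1 in V]`** for the `(2;2)` datum near a flat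
boundary (and the two points lie on the row of `a`). [cite: BaxterKellandWu1976, §3–§4] -/
theorem r22_ratio_eq (V : Finset (ℤ × ℤ)) (a : ℤ × ℤ) (m M : ℝ) (hm : 1 ≤ m) (hM : 9 ≤ M)
    (hCR : ChartRegular V)
    (hK : ∀ u ∉ V, ∀ w ∉ V, Relation.ReflTransGen
      (fun b c : ℤ × ℤ ↦ b ∉ V ∧ c ∉ V ∧ max |b.1 - c.1| |b.2 - c.2| ≤ 1) u w)
    (hV : ∀ v : ℤ × ℤ, ((((v.1 - a.1) ^ 2 + (v.2 - a.2) ^ 2 : ℤ) : ℝ)) ≤ (M * m) ^ 2 → (v ∈ V ↔ 0 ≤ v.2 - a.2))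
    (p : Fin 2 → ℤ × ℤ)
    (hdist : ∀ i, (((((p i).1 - a.1) ^ 2 + ((p i).2 - a.2) ^ 2 : ℤ) : ℝ)) ≤ m ^ 2)
    (hadm : LegInsertionData.IsAdmissible (⟨(Finset.univ.erase 1).image p,
      fun v ↦ ∑ b ∈ (Finset.univ.erase 1).filter (fun b ↦ p b = v), (![2, 2] : Fin 2 → ℕ) b, p 1⟩ :
        LegInsertionData) V)
    (hpos : 0 < ‖Zins V (⟨(Finset.univ.erase 1).image p,
      fun v ↦ ∑ b ∈ (Finset.univ.erase 1).filter (fun b ↦ p b = v), (![2, 2] : Fin 2 → ℕ) b, p 1⟩ :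
        LegInsertionData)‖ / ‖(ofDomain V).Z‖) :
    (p 0).2 = a.2 ∧ (p 1).2 = a.2 ∧
    ‖Zins V (⟨(Finset.univ.erase 1).image p,
      fun v ↦ ∑ b ∈ (Finset.univ.erase 1).filter (fun b ↦ p b = v), (![2, 2] : Fin 2 → ℕ) b, p 1⟩ :
        LegInsertionData)‖ / ‖(ofDomain V).Z‖ =
      (bondPercolation (zdGraph 2) half).real (openConnIn
        (↑(V.image (fun v : ℤ × ℤ => (![v.1, v.2] : Fin 2 → ℤ))) : Set (Fin 2 → ℤ))
        (![(p 0).1, (p 0).2] : Fin 2 → ℤ) (![(p 1).1, (p 1).2] : Fin 2 → ℤ)) := by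
  classical
  set ι : LegInsertionData := ⟨(Finset.univ.erase 1).image p,
    fun v ↦ ∑ b ∈ (Finset.univ.erase 1).filter (fun b ↦ p b = v), (![2, 2] : Fin 2 → ℕ) b, p 1⟩ with hι
  obtain ⟨hsrc, hlegs, hsink⟩ : ι.source = {p 0} ∧ ι.legs (p 0) = 2 ∧ ι.sink = p 1 := r22_datum p
  have hL : ι.sinkLegs = 2 := r22_sinkLegs ι hsrc hlegs
  have hins : ∀ z ∈ insert ι.sink ι.source, z = p 1 ∨ z = p 0 := by
    intro z hz; rw [hsrc, hsink, mem_insert, mem_singleton] at hz; exact hz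
  -- the two points are on the row
  have hrow : ∀ z ∈ insert ι.sink ι.source, ((((z.1 - a.1) ^ 2 + (z.2 - a.2) ^ 2 : ℤ) : ℝ)) ≤ m ^ 2 ∧ z.2 = a.2 := by
    intro z hz
    obtain ⟨hzV, hcard, -⟩ := hadm.2.2.2.1 z hz
    have hzd : ((((z.1 - a.1) ^ 2 + (z.2 - a.2) ^ 2 : ℤ) : ℝ)) ≤ m ^ 2 := by
      rcases hins z hz with rfl | rfl <;> exact hdist _
    exact ⟨hzd, r22_row hm hM hV hzd hzV hcard⟩
  have h1row : (p 1).2 = a.2 := (hrow _ (mem_insert_self _ _)).2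
  have h0row : (p 0).2 = a.2 := (hrow (p 0) (by rw [hsrc]; simp)).2
  refine ⟨h0row, h1row, ?_⟩
  -- flatness at radius `sinkLegs + 4 = 6` and `sinkLegs + 3 = 5`
  have hflat4 : ∀ z ∈ insert ι.sink ι.source, ∃ dvec : ℤ × ℤ,
      (dvec = (1, 0) ∨ dvec = (-1, 0) ∨ dvec = (0, 1) ∨ dvec = (0, -1)) ∧
      ∀ v : ℤ × ℤ, (v.1 - z.1) ^ 2 + (v.2 - z.2) ^ 2 ≤ ((ι.sinkLegs : ℤ) + 4) ^ 2 →
        (v ∈ V ↔ 0 ≤ (v.1 - z.1) * dvec.1 + (v.2 - z.2) * dvec.2) := by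
    intro z hz
    rw [hL]
    exact r22_flat hm hM hV (hrow z hz).1 (hrow z hz).2 (by norm_num)
  have hflat3 : ∀ z ∈ insert ι.sink ι.source, ∃ dvec : ℤ × ℤ,
      (dvec = (1, 0) ∨ dvec = (-1, 0) ∨ dvec = (0, 1) ∨ dvec = (0, -1)) ∧
      ∀ v : ℤ × ℤ, (v.1 - z.1) ^ 2 + (v.2 - z.2) ^ 2 ≤ ((ι.sinkLegs : ℤ) + 3) ^ 2 →
        (v ∈ V ↔ 0 ≤ (v.1 - z.1) * dvec.1 + (v.2 - z.2) * dvec.2) := by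
    intro z hz
    rw [hL]
    exact r22_flat hm hM hV (hrow z hz).1 (hrow z hz).2 (by norm_num)
  -- configurations exist (the ratio is positive)
  have hne : ((ι.model V).configs).Nonempty := by
    by_contra h
    rw [not_nonempty_iff_eq_empty] at h
    have h0 : Zins V ι = 0 := by
      rw [Zins, show (ι.model V).Z = ∑ h ∈ (ι.model V).configs, (ι.model V).weight h from rfl, h, sum_empty]
    rw [h0, norm_zero, zero_div] at hpos
    exact lt_irrefl _ hpos
  -- dictionary, closed collar, identification, count
  have hdict := s17_dictionary ι V hadm hflat4 hCR.2.1 hCR.1 hK hCR.2.2 hne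
  have hZ := norm_Z_ofDomain hK
  have hA := s18_rainbow22_iff_conn ι V (p 0) hsrc hlegs hadm hflat3 hCR.2.1
  have hcount := r22_prob_eq_card V (p 0) (p 1)
  have hfilter : (ι.model V).E.powerset.filter (fun ω => ι.Rainbow V ω) =
      (inducedEdges V).powerset.filter (fun ω => (↑(ω.image edgeSym2) : Set (Sym2 (Site 2))) ∈
        openConnIn (↑(V.image toSite) : Set (Site 2)) (toSite (p 0)) (toSite (p 1))) := by
    refine filter_congr fun ω hω => ?_
    rw [hA ω (mem_powerset.1 hω), hsink]
    rfl
  rw [hdict, hZ, hfilter]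
  exact hcount.symm

/-! ### Registered form: RAINBOW LOCALITY for `k = 2`, `L = ![2, 2]`, `j = 1` -/

/-- **Sub-goal `s18_rainbowLocality_22`** (registered on stmt-CriticalPhenomena-14132): the `(2;2)` MEMBER of
the open stub `stub_rainbowLocality` of line `rainbow-monomials-in-excursion-kernels` — its text with
`k := 2`, `L := ![2, 2]`, `j := 1` substituted: for chart-regular `V, V'` with king-connected complements,
flat at radius `M·m` about `a, a'`, and the `(2;2)` datum at points `p` within `m` of `a` (translated by
`a' - a` in `V'`), admissible with positive rainbow ratios,
`|log (‖Zins_V‖/‖Z_V‖) - log (‖Zins_V'‖/‖Z_V'‖)| ≤ ε` once `M ≥ M(ε)`: the ratio is `P_{1/2}[p 0 ↔ p 1 in V]`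
(`r22_ratio_eq`) and the two-point function is local (`s12_twoPointLocality`). [cite: BaxterKellandWu1976, §3–§4] -/
theorem s18_rainbowLocality_22 : (![2, 2] : Fin 2 → ℕ) 1 = ∑ i ∈ Finset.univ.erase 1, (![2, 2] : Fin 2 → ℕ) i → ∀ ε : ℝ, 0 < ε → ∃ M : ℝ, 0 < M ∧ ∀ (V V' : Finset (ℤ × ℤ)) (a a' : ℤ × ℤ) (m : ℝ), 1 ≤ m → Literature.Probability.LatticeModels.CollarLegModel.ChartRegular V → (∀ u ∉ V, ∀ w ∉ V, Relation.ReflTransGen (fun b c : ℤ × ℤ ↦ b ∉ V ∧ c ∉ V ∧ max |b.1 - c.1| |b.2 - c.2| ≤ 1) u w) → Literature.Probability.LatticeModels.CollarLegModel.ChartRegular V' → (∀ u ∉ V', ∀ w ∉ V', Relation.ReflTransGen (fun b c : ℤ × ℤ ↦ b ∉ V' ∧ c ∉ V' ∧ max |b.1 - c.1| |b.2 - c.2| ≤ 1) u w) → (∀ v : ℤ × ℤ, ((((v.1 - a.1) ^ 2 + (v.2 - a.2) ^ 2 : ℤ) : ℝ)) ≤ (M * m) ^ 2 → (v ∈ V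 ↔ 0 ≤ v.2 - a.2)) → (∀ v : ℤ × ℤ, ((((v.1 - a'.1) ^ 2 + (v.2 - a'.2) ^ 2 : ℤ) : ℝ)) ≤ (M * m) ^ 2 → (v ∈ V' ↔ 0 ≤ v.2 - a'.2)) → ∀ (p : Fin 2 → ℤ × ℤ), Function.Injective p → (∀ i, (((((p i).1 - a.1) ^ 2 + ((p i).2 - a.2) ^ 2 : ℤ) : ℝ)) ≤ m ^ 2) → Literature.Probability.LatticeModels.CollarLegModel.LegInsertionData.IsAdmissible (⟨(Finset.univ.erase 1).image p, fun v ↦ ∑ b ∈ (Finset.univ.erase 1).filter (fun b ↦ p b = v), (![2, 2] : Fin 2 → ℕ) b, p 1⟩ : Literature.Probability.LatticeModels.CollarLegModel.LegInsertionData) V → Literature.Probability.LatticeModels.CollarLegModel.LegInsertionData.IsAdmissible (⟨(Finset.univ.erase 1).image (fun i ↦ p i - a + a'), fun v ↦ ∑ b ∈ (Finset.univ.erase 1).filter (fun b ↦ (fun i ↦ p i - a + a') b = v), (![2, 2] : Fin 2 → ℕ) b, (fun i ↦ p i - a + a') 1⟩ : Literature.Probability.LatticeModels.CollarLegModel.LegInsertionData)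 V' → 0 < (‖Literature.Probability.LatticeModels.CollarLegModel.Zins V (⟨(Finset.univ.erase 1).image p, fun v ↦ ∑ b ∈ (Finset.univ.erase 1).filter (fun b ↦ p b = v), (![2, 2] : Fin 2 → ℕ) b, p 1⟩ : Literature.Probability.LatticeModels.CollarLegModel.LegInsertionData)‖ / ‖(Literature.Probability.LatticeModels.CollarLegModel.ofDomain V).Z‖) → 0 < (‖Literature.Probability.LatticeModels.CollarLegModel.Zins V' (⟨(Finset.univ.erase 1).image (fun i ↦ p i - a + a'), fun v ↦ ∑ b ∈ (Finset.univ.erase 1).filter (fun b ↦ (fun i ↦ p i - a + a') b = v), (![2, 2] : Fin 2 → ℕ) b, (fun i ↦ p i - a + a') 1⟩ : Literature.Probability.LatticeModels.CollarLegModel.LegInsertionData)‖ / ‖(Literature.Probability.LatticeModels.CollarLegModel.ofDomain V').Z‖) → |Real.log (‖Literature.Probability.LatticeModels.CollarLegModel.Zins V (⟨(Finset.univ.erase 1).image p, fun v ↦ ∑ b ∈ (Finset.univ.erase 1).filter (fun b ↦ p b = v), (![2, 2] : Fin 2 → ℕ) b, p 1⟩ : Literature.Probability.LatticeModels.CollarLegModel.LegInsertionData)‖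 / ‖(Literature.Probability.LatticeModels.CollarLegModel.ofDomain V).Z‖) - Real.log (‖Literature.Probability.LatticeModels.CollarLegModel.Zins V' (⟨(Finset.univ.erase 1).image (fun i ↦ p i - a + a'), fun v ↦ ∑ b ∈ (Finset.univ.erase 1).filter (fun b ↦ (fun i ↦ p i - a + a') b = v), (![2, 2] : Fin 2 → ℕ) b, (fun i ↦ p i - a + a') 1⟩ : Literature.Probability.LatticeModels.CollarLegModel.LegInsertionData)‖ / ‖(Literature.Probability.LatticeModels.CollarLegModel.ofDomain V').Z‖)| ≤ ε := by
  intro _ ε hε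
  obtain ⟨M₀, hM₀, hloc⟩ := s12_twoPointLocality ε hε
  refine ⟨max M₀ 9, lt_of_lt_of_le hM₀ (le_max_left _ _), ?_⟩
  intro V V' a a' m hm hCR hK hCR' hK' hV hV' p hp hdist hadm hadm' hpos hpos'
  have hM9 : (9 : ℝ) ≤ max M₀ 9 := le_max_right _ _
  obtain ⟨h0, h1, hratio⟩ := r22_ratio_eq V a m (max M₀ 9) hm hM9 hCR hK hV p hdist hadm hpos
  have hp' : Function.Injective (fun i ↦ p i - a + a') := fun i j h => hp (by simpa using h)
  have hdist' : ∀ i, ((((((fun i ↦ p i - a + a') i).1 - a'.1) ^ 2 +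
      (((fun i ↦ p i - a + a') i).2 - a'.2) ^ 2 : ℤ) : ℝ)) ≤ m ^ 2 := by
    intro i
    have e1 : ((fun i ↦ p i - a + a') i).1 - a'.1 = (p i).1 - a.1 := by simp
    have e2 : ((fun i ↦ p i - a + a') i).2 - a'.2 = (p i).2 - a.2 := by simp
    rw [e1, e2]; exact hdist i
  obtain ⟨-, -, hratio'⟩ := r22_ratio_eq V' a' m (max M₀ 9) hm hM9 hCR' hK' hV' _ hdist' hadm' hpos'
  have hd : ∀ i, ((((p i).1 - a.1) ^ 2 : ℤ) : ℝ) ≤ m ^ 2 := by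
    intro i
    have := hdist i
    push_cast at this ⊢
    nlinarith [sq_nonneg (((p i).2 : ℝ) - a.2)]
  have hne : p 0 ≠ p 1 := fun h => absurd (hp h) (by decide)
  obtain ⟨-, -, hfinal⟩ := hloc V V' a a' (p 0) (p 1) m (max M₀ 9) hm (le_max_left _ _) hV hV' h0 h1
    (hd 0) (hd 1) hne
  rw [hratio, hratio']
  exact hfinal

end Summit.CriticalPhenomena.CardyFormulaZ2.Cruxes.BoundaryDefectGaussianR.RainbowMonomialsInExcursionKernels

end
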